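/-
Copyright (c) 2026 the pub-hodgecm-mathlib formalisation cell (harness21).  Prover seat hodgecm-mathlib-K2E3-p23 (g5), HCML Track B «K2-LIT» ∕ h413
(`stmt-HodgeConjecture-24833`), line `K2_E3_EllipticInputs`, unit U12 «Characters», road «GL-[M6]-sc» (line lead K2E3-p23 (g5), dealer K2E3-plan (g3)),
MEMO «M6sc-BLUEPRINT v4» §2 brick VOL-mixed, FILE A: the `N_{(2,1)}`-shear count at a regular Levi element.  2026-09-04.
-/
import Summits.HodgeConjecture.HodgeConjecture.Theorems.K2E3GL3SplitShearCount          -- ★ V2 p858163 (K2E3-p14 g5): the split twin; brings ★ B4-0 `adBall` kit, ★ V0, ★ `isCompact_setOf_scaled_integral`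
import Literature.NumberTheory.Automorphic.GLnTwoBlockBoxAdLIntegral                     -- ★ `det_one_sub_boxAd_conj_eq`; brings ★ `exists_homeomorph_unipotentRadicalGL_conj_eq` ∕ `…_parabolic_conj`
import Literature.NumberTheory.Automorphic.GLnTwoBlockLeviStructure                      -- ★ `mem_standardLeviGL_iff`
import HarnessLib

/-!
# Road «GL-[M6]-sc», brick VOL-mixed, FILE A: the `N_{(2,1)}`-SHEAR COUNT — `μ_U {u : 𝔅_m(u p u⁻¹)} ≤ ‖det(1 − K_p)‖_F⁻¹ · μ_U(Box_m)` for `p ∈ M_{(2,1)}` regular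

Cell `pub/hodgecm-mathlib` (D-0151), Track B «K2-LIT», crux H413 = `stmt-HodgeConjecture-24833`, route of record `HCCMUnconditional`.  Lane
`--supports stmt-HodgeConjecture-24833 --as helper`; THEOREMS ONLY (no `def`, no `instance`, no `notation`, no named-fact hypothesis, no `sorry`); count-neutral.

WHAT.  `c = ![false, false, true]` labels the standard parabolic `P = P_{(2,1)} = M ⋉ U` of `GL₃(F)` (`M = GL₂ × GL₁` block diagonal, `U ≅ F²` the column-`2` radical).
For `p ∈ M` the twisted commutator `u ↦ u p u⁻¹ p⁻¹` of `U` is LINEAR in the box chart with matrix `1 − K_p` (★ `exists_homeomorph_unipotentRadicalGL_conj_eq`, Rogawski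
4.13.1: `T_* μ_U = ‖det(1 − K_p)‖⁻¹ μ_U`), and for `p ∈ M` the height-ball condition `𝔅_m(u′ p)` pins `u′` in the BOX `{|ϖ^m u′_{ij}| ≤ 1}` (the products
`(u′p)_{i2} · ((u′p)⁻¹)_{22} = x_i c · c⁻¹ = x_i` are among those `𝔅_m` bounds).  Hence
* **`measure_setOf_adBall_conj_levi_le`** — `μ_U {u : 𝔅_m(u p u⁻¹)} ≤ ‖det(1 − K_p)‖_F⁻¹ · μ_U {u : ∀ i j, |ϖ^m u_{ij}| ≤ 1}` for `p ∈ M`, `det(1 − K_p) ≠ 0`;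
* `measure_setOf_adBall_conj_conj_eq` — `μ_U {u : 𝔅_m(v (u p u⁻¹) v⁻¹)} = μ_U {u : 𝔅_m(u (v p v⁻¹) u⁻¹)}` for `v ∈ P` with `‖det K_v‖ = 1` (`Ad(v)` preserves `μ_U`; used with
  `v = E₀₁(b) ∈ N_M`, `K_v = [[1,b],[0,1]]`), and ★ `det_one_sub_boxAd_conj_eq` keeps the Jacobian;
* `det_one_sub_boxAd_of_mem_standardLeviGL` — for `p ∈ M` with `GL₂`-block `h` and corner `c = p₂₂`: `det(1 − K_p) = (1 − h₀₀/c)(1 − h₁₁/c) − h₀₁h₁₀/c²` (`= π_h(c)/c²`,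
  `π_h` the characteristic polynomial of `h`; for the companion block `!![0, −N₀; 1, T]` this is `(c² − Tc + N₀)/c²`), non-zero iff `c` is not an eigenvalue of `h`;
* `isCompact_uBox`, `measure_uBox_lt_top` — the box is compact, so the constant is finite.
WHY.  In the `k · n · a` count of `{z : 𝔅_R(z), 𝔅_m(z γ z⁻¹)}` for the MIXED torus (`γ = leviBlock(C_π, c)`, BLUEPRINT v4 §2, RULINGS (M12-5)∕(M13-3)) with `n = v·u ∈ N_M·U`
and `γ_a = aγa⁻¹ ∈ M`: `z γ z⁻¹ = k · v (u γ_a u⁻¹) v⁻¹ · k⁻¹`, and this file bounds the `u`-integral by `‖π(c)/c²‖⁻¹ · μ_U(Box_m)` UNIFORMLY in `(k, v, a)`; the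
remaining `(a, v)`-count is ★ `K2E3GL2EllipticConjugacyCountSharp` × ★ V3 `K2E3GL3TorusWindowCount`.
HONEST LABEL: HC_CM is proved only modulo the 7 printed citations (2 remaining named inputs: hLiu418 = stmt-HodgeConjecture-24832, h413 = stmt-HodgeConjecture-24833) until
rung 0 closes; count-neutral helper, closes no socket.

## References
* [HarishChandra1970] Harish-Chandra (notes by G. van Dijk), *Harmonic Analysis on Reductive p-adic Groups*, LNM 162 (1970), Part VII §3 pp. 71–72.
* [Rogawski1990] J. D. Rogawski, *Automorphic Representations of Unitary Groups in Three Variables* (1990), §4.13, proof of Lemma 4.13.1, p. 70.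
* [BernsteinZelevinsky1977] I. N. Bernstein, A. V. Zelevinsky, *Induced representations of reductive p-adic groups I* (1977), §2.1.
-/

set_option autoImplicit false
-- the mandated namespace repeats the single-problem summit's segment (`HodgeConjecture.HodgeConjecture`)
set_option linter.dupNamespace false

noncomputable section

open MeasureTheory Measure Set Function Topology
open scoped MatrixGroups NNReal ENNReal WithZero
open Matrix ValuativeRel
open Literature.NumberTheory.Automorphic Literature.NumberTheory.GaloisRepresentations Literature.NumberTheory.GaloisRepresentations.IsNonarchimedeanLocalField
open Summit.HodgeConjecture.HodgeConjecture.Cruxes.H413.K2E3GLnAdHeightBalls Summit.HodgeConjecture.HodgeConjecture.Cruxes.H413.K2E3GL3HeightBallExhaustion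

namespace Summit.HodgeConjecture.HodgeConjecture.Cruxes.H413.K2E3GL3MixedShearCount

/-! ## §1 Entries of `u ∈ U_{(2,1)}`, of `p ∈ M_{(2,1)}`, and of `u p` -/

section Entries

variable {F : Type*} [Field F]

/-- For `u ∈ U_{(2,1)}` every entry off the positions `(0,2), (1,2)` is that of the identity. [cite: BernsteinZelevinsky1977, §2.1] -/
theorem apply_eq_one_apply_of_mem {u : GL (Fin 3) F} (hu : u ∈ unipotentRadicalGL F (![false, false, true] : Fin 3 → Bool)) {i j : Fin 3}
    (hij : ¬ ((i = 0 ∨ i = 1) ∧ j = 2)) : (u : Matrix (Fin 3) (Fin 3) F) i j = (1 : Matrix (Fin 3) (Fin 3) F) i j := by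
  obtain ⟨hT, h1⟩ := (mem_unipotentRadicalGL_iff_entry (R := F) (c := (![false, false, true] : Fin 3 → Bool)) u).1 hu
  by_cases hc : (![false, false, true] : Fin 3 → Bool) i = (![false, false, true] : Fin 3 → Bool) j
  · exact h1 i j hc
  · -- then `c j < c i` (the only pairs with `c i < c j` are `(0,2), (1,2)`), and the entry vanishes
    have hlt : (![false, false, true] : Fin 3 → Bool) j < (![false, false, true] : Fin 3 → Bool) i := by
      fin_cases i <;> fin_cases j <;> simp_all
    have hne : i ≠ j := by rintro rfl; exact hc rfl
    rw [hT hlt, Matrix.one_apply_ne hne]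

/-- `u₂₂ = 1` for `u ∈ U_{(2,1)}` (and for its inverse). [folklore] -/
theorem apply_two_two_of_mem {u : GL (Fin 3) F} (hu : u ∈ unipotentRadicalGL F (![false, false, true] : Fin 3 → Bool)) :
    (u : Matrix (Fin 3) (Fin 3) F) 2 2 = 1 := by
  rw [apply_eq_one_apply_of_mem hu (by decide), Matrix.one_apply_eq]

/-- For `p ∈ M_{(2,1)}` the entries `p_{k2}` (`k ≠ 2`) and `p_{2k}` (`k ≠ 2`) vanish. [cite: BernsteinZelevinsky1977, §2.1] -/
theorem apply_eq_zero_of_mem_levi {p : GL (Fin 3) F} (hp : p ∈ standardLeviGL F (![false, false, true] : Fin 3 → Bool)) {i j : Fin 3}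
    (hij : (![false, false, true] : Fin 3 → Bool) i ≠ (![false, false, true] : Fin 3 → Bool) j) : (p : Matrix (Fin 3) (Fin 3) F) i j = 0 :=
  (mem_standardLeviGL_iff (R := F) (c := (![false, false, true] : Fin 3 → Bool)) p).1 hp i j hij

/-- For `p ∈ M_{(2,1)}`: `p₂₂ · (p⁻¹)₂₂ = 1`. [folklore] -/
theorem apply_two_two_mul_inv_apply_two_two {p : GL (Fin 3) F} (hp : p ∈ standardLeviGL F (![false, false, true] : Fin 3 → Bool)) :
    (p : Matrix (Fin 3) (Fin 3) F) 2 2 * ((p⁻¹ : GL (Fin 3) F) : Matrix (Fin 3) (Fin 3) F) 2 2 = 1 := by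
  have hmul : ((p : Matrix (Fin 3) (Fin 3) F) * ((p⁻¹ : GL (Fin 3) F) : Matrix (Fin 3) (Fin 3) F)) 2 2 = 1 := by
    rw [← Units.val_mul, mul_inv_cancel, Units.val_one, Matrix.one_apply_eq]
  rw [Matrix.mul_apply, Fin.sum_univ_three, apply_eq_zero_of_mem_levi hp (i := 2) (j := 0) (by decide),
    apply_eq_zero_of_mem_levi hp (i := 2) (j := 1) (by decide), zero_mul, zero_mul, zero_add, zero_add] at hmul
  exact hmul

/-- **`(u p)_{i2} · ((u p)⁻¹)_{22} = u_{i2}`** for `u ∈ U_{(2,1)}`, `p ∈ M_{(2,1)}`, `i ∈ {0, 1}`: the column-`2` coordinates of `u` are READ OFF the products that `𝔅_m(u p)`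
bounds (the identity holds for every row `i`). [cite: HarishChandra1970, Part VII §3 p. 72] -/
theorem mul_apply_two_mul_inv_apply_two_two {u p : GL (Fin 3) F} (hu : u ∈ unipotentRadicalGL F (![false, false, true] : Fin 3 → Bool))
    (hp : p ∈ standardLeviGL F (![false, false, true] : Fin 3 → Bool)) (i : Fin 3) :
    ((u * p : GL (Fin 3) F) : Matrix (Fin 3) (Fin 3) F) i 2 * (((u * p)⁻¹ : GL (Fin 3) F) : Matrix (Fin 3) (Fin 3) F) 2 2 = (u : Matrix (Fin 3) (Fin 3) F) i 2 := by
  have hu' : u⁻¹ ∈ unipotentRadicalGL F (![false, false, true] : Fin 3 → Bool) := Subgroup.inv_mem _ hu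
  have hp' : p⁻¹ ∈ standardLeviGL F (![false, false, true] : Fin 3 → Bool) := Subgroup.inv_mem _ hp
  -- `(u p)_{i2} = u_{i2} p₂₂`
  have h1 : ((u * p : GL (Fin 3) F) : Matrix (Fin 3) (Fin 3) F) i 2 = (u : Matrix (Fin 3) (Fin 3) F) i 2 * (p : Matrix (Fin 3) (Fin 3) F) 2 2 := by
    rw [Units.val_mul, Matrix.mul_apply, Fin.sum_univ_three, apply_eq_zero_of_mem_levi hp (i := 0) (j := 2) (by decide),
      apply_eq_zero_of_mem_levi hp (i := 1) (j := 2) (by decide), mul_zero, mul_zero, zero_add, zero_add]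
  -- `((u p)⁻¹)₂₂ = (p⁻¹)₂₂`
  have h2 : (((u * p)⁻¹ : GL (Fin 3) F) : Matrix (Fin 3) (Fin 3) F) 2 2 = ((p⁻¹ : GL (Fin 3) F) : Matrix (Fin 3) (Fin 3) F) 2 2 := by
    rw [_root_.mul_inv_rev, Units.val_mul, Matrix.mul_apply, Fin.sum_univ_three, apply_eq_zero_of_mem_levi hp' (i := 2) (j := 0) (by decide),
      apply_eq_zero_of_mem_levi hp' (i := 2) (j := 1) (by decide), zero_mul, zero_mul, zero_add, zero_add, apply_two_two_of_mem hu', mul_one]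
  rw [h1, h2, mul_assoc, apply_two_two_mul_inv_apply_two_two hp, mul_one]

/-- For `u ∈ U_{(2,1)}`: `(u⁻¹)_{i2} = −u_{i2}` (`i ∈ {0,1}`), read off `u · u⁻¹ = 1`. [folklore] -/
theorem inv_apply_two_eq_neg_of_mem {u : GL (Fin 3) F} (hu : u ∈ unipotentRadicalGL F (![false, false, true] : Fin 3 → Bool)) {i : Fin 3} (hi : i = 0 ∨ i = 1) :
    ((u⁻¹ : GL (Fin 3) F) : Matrix (Fin 3) (Fin 3) F) i 2 = -(u : Matrix (Fin 3) (Fin 3) F) i 2 := by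
  have hu' : u⁻¹ ∈ unipotentRadicalGL F (![false, false, true] : Fin 3 → Bool) := Subgroup.inv_mem _ hu
  have hmul : ((u : Matrix (Fin 3) (Fin 3) F) * ((u⁻¹ : GL (Fin 3) F) : Matrix (Fin 3) (Fin 3) F)) i 2 = 0 := by
    rw [← Units.val_mul, mul_inv_cancel, Units.val_one, Matrix.one_apply_ne]
    rcases hi with rfl | rfl <;> decide
  rw [Matrix.mul_apply, Fin.sum_univ_three, apply_two_two_of_mem hu'] at hmul
  rcases hi with rfl | rfl
  · rw [apply_eq_one_apply_of_mem hu (i := 0) (j := 0) (by decide), apply_eq_one_apply_of_mem hu (i := 0) (j := 1) (by decide),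
      Matrix.one_apply_eq, Matrix.one_apply_ne (by decide), one_mul, zero_mul, add_zero, mul_one] at hmul
    linear_combination hmul
  · rw [apply_eq_one_apply_of_mem hu (i := 1) (j := 0) (by decide), apply_eq_one_apply_of_mem hu (i := 1) (j := 1) (by decide),
      Matrix.one_apply_eq, Matrix.one_apply_ne (by decide), one_mul, zero_mul, zero_add, mul_one] at hmul
    linear_combination hmul

variable [Valued F ℤᵐ⁰]

/-- **`𝔅_m(u p) ⇒ u ∈ Box_m`** (`|ϖ^m u_{ij}| ≤ 1` for all `i j`) for `u ∈ U_{(2,1)}`, `p ∈ M_{(2,1)}`, `|ϖ| ≤ 1`. [cite: HarishChandra1970, Part VII §3 p. 72] -/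
theorem forall_v_pow_mul_apply_le_one_of_adBall_mul {ϖ : F} (hϖ1 : Valued.v ϖ ≤ 1) {m : ℕ} {u p : GL (Fin 3) F}
    (hu : u ∈ unipotentRadicalGL F (![false, false, true] : Fin 3 → Bool)) (hp : p ∈ standardLeviGL F (![false, false, true] : Fin 3 → Bool))
    (h : ∀ i j k l, Valued.v (ϖ ^ m * (((u * p : GL (Fin 3) F) : Matrix (Fin 3) (Fin 3) F) i j * (((u * p)⁻¹ : GL (Fin 3) F) : Matrix (Fin 3) (Fin 3) F) k l)) ≤ 1)
    (i j : Fin 3) : Valued.v (ϖ ^ m * (u : Matrix (Fin 3) (Fin 3) F) i j) ≤ 1 := by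
  by_cases hij : (i = 0 ∨ i = 1) ∧ j = 2
  · obtain ⟨-, rfl⟩ := hij
    have := h i 2 2 2
    rwa [mul_apply_two_mul_inv_apply_two_two hu hp i] at this
  · rw [apply_eq_one_apply_of_mem hu hij, Matrix.one_apply]
    split_ifs
    · rw [mul_one, map_pow]; exact pow_le_one₀ zero_le hϖ1
    · rw [mul_zero, map_zero]; exact zero_le

/-- `u ∈ Box_m ⇒ u⁻¹ ∈ Box_m` on `U_{(2,1)}` (`(u⁻¹)_{i2} = −u_{i2}`). [folklore] -/
theorem forall_v_pow_mul_inv_apply_le_one_of_mem {ϖ : F} {m : ℕ} {u : GL (Fin 3) F} (hu : u ∈ unipotentRadicalGL F (![false, false, true] : Fin 3 → Bool))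
    (h : ∀ i j, Valued.v (ϖ ^ m * (u : Matrix (Fin 3) (Fin 3) F) i j) ≤ 1) (i j : Fin 3) :
    Valued.v (ϖ ^ m * ((u⁻¹ : GL (Fin 3) F) : Matrix (Fin 3) (Fin 3) F) i j) ≤ 1 := by
  have hu' : u⁻¹ ∈ unipotentRadicalGL F (![false, false, true] : Fin 3 → Bool) := Subgroup.inv_mem _ hu
  by_cases hij : (i = 0 ∨ i = 1) ∧ j = 2
  · obtain ⟨hi, rfl⟩ := hij
    rw [inv_apply_two_eq_neg_of_mem hu hi, mul_neg, Valuation.map_neg]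
    exact h i 2
  · rw [apply_eq_one_apply_of_mem hu' hij, ← apply_eq_one_apply_of_mem hu hij]
    exact h i j

end Entries

/-! ## §2 The box is compact -/

section Box

variable {F : Type*} [Field F] [Valued F ℤᵐ⁰] [ValuativeRel F] [(Valued.v : Valuation F ℤᵐ⁰).Compatible] [IsNonarchimedeanLocalField F]

/-- **THE `U`-BOX OF RADIUS `m` IS COMPACT**: `{u ∈ U_{(2,1)} : |ϖ^m u_{ij}| ≤ 1 ∀ i j}` is a closed subset of the compact GL-ball ★ `isCompact_setOf_scaled_integral`.
[cite: HarishChandra1970, Part VII §2 p. 69] -/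
theorem isCompact_uBox {ϖ : F} (hϖ : Valued.v ϖ = WithZero.exp (-1 : ℤ)) (m : ℕ) :
    IsCompact {u : ↥(unipotentRadicalGL F (![false, false, true] : Fin 3 → Bool)) | ∀ i j, Valued.v (ϖ ^ m * ((u : GL (Fin 3) F) : Matrix (Fin 3) (Fin 3) F) i j) ≤ 1} := by
  haveI : IsTopologicalRing F := inferInstance
  haveI : T2Space F := (isLocalField F).toT2Space
  have hϖ0 : ϖ ≠ 0 := ne_zero_of_v_eq_exp hϖ
  rw [Subtype.isCompact_iff]
  have hsub : ((↑) : ↥(unipotentRadicalGL F (![false, false, true] : Fin 3 → Bool)) → GL (Fin 3) F) ''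
      {u : ↥(unipotentRadicalGL F (![false, false, true] : Fin 3 → Bool)) | ∀ i j, Valued.v (ϖ ^ m * ((u : GL (Fin 3) F) : Matrix (Fin 3) (Fin 3) F) i j) ≤ 1} =
      (unipotentRadicalGL F (![false, false, true] : Fin 3 → Bool) : Set (GL (Fin 3) F)) ∩
        {g : GL (Fin 3) F | ∀ i j, Valued.v (ϖ ^ m * (g : Matrix (Fin 3) (Fin 3) F) i j) ≤ 1} := by
    ext g
    constructor
    · rintro ⟨u, hu, rfl⟩; exact ⟨u.2, hu⟩
    · rintro ⟨hg, hb⟩; exact ⟨⟨g, hg⟩, hb, rfl⟩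
  rw [hsub]
  refine (isCompact_setOf_scaled_integral (n := Fin 3) hϖ0 m m).of_isClosed_subset ?_ ?_
  · refine (isClosed_unipotentRadicalGL (R := F) (![false, false, true] : Fin 3 → Bool)).inter ?_
    have hC : IsClosed {x : F | Valued.v x ≤ 1} := Valued.isClosed_integer F
    simp only [Set.setOf_forall]
    exact isClosed_iInter fun i => isClosed_iInter fun j => hC.preimage (continuous_const.mul (Units.continuous_val.matrix_elem i j))
  · rintro g ⟨hg, hb⟩
    exact ⟨hb, forall_v_pow_mul_inv_apply_le_one_of_mem hg hb⟩

/-- The `U`-box has FINITE measure for every measure finite on compacta — the local constant of the count. [cite: HarishChandra1970, Part VII §3 p. 72] -/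
theorem measure_uBox_lt_top {ϖ : F} (hϖ : Valued.v ϖ = WithZero.exp (-1 : ℤ)) (m : ℕ)
    [MeasurableSpace (GL (Fin 3) F)] [BorelSpace (GL (Fin 3) F)]
    (ν : Measure ↥(unipotentRadicalGL F (![false, false, true] : Fin 3 → Bool))) [IsFiniteMeasureOnCompacts ν] :
    ν {u | ∀ i j, Valued.v (ϖ ^ m * ((u : GL (Fin 3) F) : Matrix (Fin 3) (Fin 3) F) i j) ≤ 1} < ⊤ :=
  (isCompact_uBox hϖ m).measure_lt_top

end Box

/-! ## §3 The shear count and the conjugation invariance -/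

section Count

variable {F : Type*} [Field F] [Valued F ℤᵐ⁰] [ValuativeRel F] [IsNonarchimedeanLocalField F]
  [MeasurableSpace (GL (Fin 3) F)] [BorelSpace (GL (Fin 3) F)]

/-- **THE `N_{(2,1)}`-SHEAR COUNT.**  For `p ∈ M_{(2,1)}` with `det(1 − K_p) ≠ 0` and every Haar measure `μ_U` of `U_{(2,1)}`:
`μ_U {u : 𝔅_m(u p u⁻¹)} ≤ ‖det(1 − K_p)‖_F⁻¹ · μ_U {u : |ϖ^m u_{ij}| ≤ 1 ∀ i j}` — Rogawski's substitution `u p u⁻¹ = T(u)·p`, `T_*μ_U = ‖det(1 − K_p)‖⁻¹μ_U` (★), then §1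
`𝔅_m(u′ p) ⇒ u′ ∈ Box_m`. [cite: HarishChandra1970, Part VII §3 p. 72] [cite: Rogawski1990, §4.13, proof of Lemma 4.13.1, p. 70] -/
theorem measure_setOf_adBall_conj_levi_le (ν : Measure ↥(unipotentRadicalGL F (![false, false, true] : Fin 3 → Bool))) [IsHaarMeasure ν]
    (p : GL (Fin 3) F) (hp : p ∈ standardLeviGL F (![false, false, true] : Fin 3 → Bool))
    (hreg : (1 - Matrix.of fun q q' : {i : Fin 3 // (![false, false, true] : Fin 3 → Bool) i = false} × {j : Fin 3 // (![false, false, true] : Fin 3 → Bool) j = true} =>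
      (((⟨p, standardLeviGL_le F _ hp⟩ : standardParabolicGL F (![false, false, true] : Fin 3 → Bool)) : GL (Fin 3) F) : Matrix (Fin 3) (Fin 3) F) q.1 q'.1 *
        ((((⟨p, standardLeviGL_le F _ hp⟩ : standardParabolicGL F (![false, false, true] : Fin 3 → Bool))⁻¹ : standardParabolicGL F (![false, false, true] : Fin 3 → Bool)) :
          GL (Fin 3) F) : Matrix (Fin 3) (Fin 3) F) q'.2 q.2).det ≠ 0)
    {ϖ : F} (hϖ1 : Valued.v ϖ ≤ 1) (m : ℕ) :
    ν {u | ∀ i j k l, Valued.v (ϖ ^ m * ((((u : GL (Fin 3) F) * p * ((u : GL (Fin 3) F))⁻¹ : GL (Fin 3) F) : Matrix (Fin 3) (Fin 3) F) i j *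
        ((((u : GL (Fin 3) F) * p * ((u : GL (Fin 3) F))⁻¹)⁻¹ : GL (Fin 3) F) : Matrix (Fin 3) (Fin 3) F) k l)) ≤ 1} ≤
      ((normAbs F ((1 - Matrix.of fun q q' : {i : Fin 3 // (![false, false, true] : Fin 3 → Bool) i = false} × {j : Fin 3 // (![false, false, true] : Fin 3 → Bool) j = true} =>
        (((⟨p, standardLeviGL_le F _ hp⟩ : standardParabolicGL F (![false, false, true] : Fin 3 → Bool)) : GL (Fin 3) F) : Matrix (Fin 3) (Fin 3) F) q.1 q'.1 *
          ((((⟨p, standardLeviGL_le F _ hp⟩ : standardParabolicGL F (![false, false, true] : Fin 3 → Bool))⁻¹ : standardParabolicGL F (![false, false, true] : Fin 3 → Bool)) :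
            GL (Fin 3) F) : Matrix (Fin 3) (Fin 3) F) q'.2 q.2).det))⁻¹ : ℝ≥0) *
        ν {u | ∀ i j, Valued.v (ϖ ^ m * ((u : GL (Fin 3) F) : Matrix (Fin 3) (Fin 3) F) i j) ≤ 1} := by
  classical
  haveI : BorelSpace ↥(unipotentRadicalGL F (![false, false, true] : Fin 3 → Bool)) := Subtype.borelSpace _
  letI : MeasurableSpace F := borel F
  haveI : BorelSpace F := ⟨rfl⟩
  obtain ⟨T, hT, hTν⟩ := exists_homeomorph_unipotentRadicalGL_conj_eq ν ⟨p, standardLeviGL_le F _ hp⟩ hreg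
  -- the set is `T⁻¹ {u′ : 𝔅_m(u′ p)}`
  set E : Set ↥(unipotentRadicalGL F (![false, false, true] : Fin 3 → Bool)) :=
    {u' | ∀ i j k l, Valued.v (ϖ ^ m * ((((u' : GL (Fin 3) F) * p : GL (Fin 3) F) : Matrix (Fin 3) (Fin 3) F) i j *
      ((((u' : GL (Fin 3) F) * p)⁻¹ : GL (Fin 3) F) : Matrix (Fin 3) (Fin 3) F) k l)) ≤ 1} with hE
  have hset : {u : ↥(unipotentRadicalGL F (![false, false, true] : Fin 3 → Bool)) | ∀ i j k l, Valued.v (ϖ ^ m *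
      ((((u : GL (Fin 3) F) * p * ((u : GL (Fin 3) F))⁻¹ : GL (Fin 3) F) : Matrix (Fin 3) (Fin 3) F) i j *
        ((((u : GL (Fin 3) F) * p * ((u : GL (Fin 3) F))⁻¹)⁻¹ : GL (Fin 3) F) : Matrix (Fin 3) (Fin 3) F) k l)) ≤ 1} = T ⁻¹' E := by
    ext u
    simp only [Set.mem_preimage, Set.mem_setOf_eq, hE]
    rw [show (u : GL (Fin 3) F) * p * ((u : GL (Fin 3) F))⁻¹ = (T u : GL (Fin 3) F) * p from hT u]
  rw [hset, ← T.toMeasurableEquiv_coe, ← MeasurableEquiv.map_apply, T.toMeasurableEquiv_coe, hTν, Measure.smul_apply, smul_eq_mul]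
  refine mul_le_mul' (le_of_eq (by rw [map_inv₀])) (measure_mono fun u' hu' => ?_)
  exact forall_v_pow_mul_apply_le_one_of_adBall_mul hϖ1 u'.2 hp hu'

/-- **`Ad(v)` on `U` preserves the count**: for `v ∈ P_{(2,1)}` whose box matrix has `‖det K_v‖_F = 1` (e.g. `v ∈ N_M`, `K_v` unipotent) and any `p`,
`μ_U {u : 𝔅_m(v (u p u⁻¹) v⁻¹)} = μ_U {u : 𝔅_m(u (v p v⁻¹) u⁻¹)}` (★ `exists_homeomorph_unipotentRadicalGL_parabolic_conj`: `u ↦ v u v⁻¹` is a homeomorphism of `U` of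
module `‖det K_v‖ = 1`). [cite: BernsteinZelevinsky1977, 1.7] -/
theorem measure_setOf_adBall_conj_conj_eq (ν : Measure ↥(unipotentRadicalGL F (![false, false, true] : Fin 3 → Bool))) [IsHaarMeasure ν]
    (v : standardParabolicGL F (![false, false, true] : Fin 3 → Bool))
    (hv : normAbs F (Matrix.of fun q q' : {i : Fin 3 // (![false, false, true] : Fin 3 → Bool) i = false} × {j : Fin 3 // (![false, false, true] : Fin 3 → Bool) j = true} =>
      ((v : GL (Fin 3) F) : Matrix (Fin 3) (Fin 3) F) q.1 q'.1 *
        (((v⁻¹ : standardParabolicGL F (![false, false, true] : Fin 3 → Bool)) : GL (Fin 3) F) : Matrix (Fin 3) (Fin 3) F) q'.2 q.2).det = 1)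
    (p : GL (Fin 3) F) (ϖ : F) (m : ℕ) :
    ν {u | ∀ i j k l, Valued.v (ϖ ^ m * ((((v : GL (Fin 3) F) * ((u : GL (Fin 3) F) * p * ((u : GL (Fin 3) F))⁻¹) * ((v : GL (Fin 3) F))⁻¹ : GL (Fin 3) F) :
        Matrix (Fin 3) (Fin 3) F) i j *
        ((((v : GL (Fin 3) F) * ((u : GL (Fin 3) F) * p * ((u : GL (Fin 3) F))⁻¹) * ((v : GL (Fin 3) F))⁻¹)⁻¹ : GL (Fin 3) F) : Matrix (Fin 3) (Fin 3) F) k l)) ≤ 1} =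
      ν {u | ∀ i j k l, Valued.v (ϖ ^ m * ((((u : GL (Fin 3) F) * ((v : GL (Fin 3) F) * p * ((v : GL (Fin 3) F))⁻¹) * ((u : GL (Fin 3) F))⁻¹ : GL (Fin 3) F) :
        Matrix (Fin 3) (Fin 3) F) i j *
        ((((u : GL (Fin 3) F) * ((v : GL (Fin 3) F) * p * ((v : GL (Fin 3) F))⁻¹) * ((u : GL (Fin 3) F))⁻¹)⁻¹ : GL (Fin 3) F) : Matrix (Fin 3) (Fin 3) F) k l)) ≤ 1} := by
  classical
  haveI : BorelSpace ↥(unipotentRadicalGL F (![false, false, true] : Fin 3 → Bool)) := Subtype.borelSpace _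
  letI : MeasurableSpace F := borel F
  haveI : BorelSpace F := ⟨rfl⟩
  obtain ⟨T, hT, -, hTν⟩ := exists_homeomorph_unipotentRadicalGL_parabolic_conj ν v
  rw [map_inv₀, hv, inv_one, ENNReal.coe_one, one_smul] at hTν
  set E : Set ↥(unipotentRadicalGL F (![false, false, true] : Fin 3 → Bool)) :=
    {u' | ∀ i j k l, Valued.v (ϖ ^ m * ((((u' : GL (Fin 3) F) * ((v : GL (Fin 3) F) * p * ((v : GL (Fin 3) F))⁻¹) * ((u' : GL (Fin 3) F))⁻¹ : GL (Fin 3) F) :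
        Matrix (Fin 3) (Fin 3) F) i j *
        ((((u' : GL (Fin 3) F) * ((v : GL (Fin 3) F) * p * ((v : GL (Fin 3) F))⁻¹) * ((u' : GL (Fin 3) F))⁻¹)⁻¹ : GL (Fin 3) F) : Matrix (Fin 3) (Fin 3) F) k l)) ≤ 1} with hE
  have hgrp : ∀ u : ↥(unipotentRadicalGL F (![false, false, true] : Fin 3 → Bool)),
      (v : GL (Fin 3) F) * ((u : GL (Fin 3) F) * p * ((u : GL (Fin 3) F))⁻¹) * ((v : GL (Fin 3) F))⁻¹ =
        (T u : GL (Fin 3) F) * ((v : GL (Fin 3) F) * p * ((v : GL (Fin 3) F))⁻¹) * ((T u : GL (Fin 3) F))⁻¹ := by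
    intro u
    rw [hT u]
    group
  have hset : {u : ↥(unipotentRadicalGL F (![false, false, true] : Fin 3 → Bool)) | ∀ i j k l, Valued.v (ϖ ^ m *
      ((((v : GL (Fin 3) F) * ((u : GL (Fin 3) F) * p * ((u : GL (Fin 3) F))⁻¹) * ((v : GL (Fin 3) F))⁻¹ : GL (Fin 3) F) : Matrix (Fin 3) (Fin 3) F) i j *
        ((((v : GL (Fin 3) F) * ((u : GL (Fin 3) F) * p * ((u : GL (Fin 3) F))⁻¹) * ((v : GL (Fin 3) F))⁻¹)⁻¹ : GL (Fin 3) F) : Matrix (Fin 3) (Fin 3) F) k l)) ≤ 1} =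
      T ⁻¹' E := by
    ext u
    simp only [Set.mem_preimage, Set.mem_setOf_eq, hE, hgrp u]
  rw [hset, ← T.toMeasurableEquiv_coe, ← MeasurableEquiv.map_apply, T.toMeasurableEquiv_coe, hTν]


/-! ## §4 The Jacobian at a Levi element: `det(1 − K_p) = (1 − p₀₀w)(1 − p₁₁w) − p₀₁p₁₀w²`, `w = (p⁻¹)₂₂` -/

omit [Valued F ℤᵐ⁰] [ValuativeRel F] [IsNonarchimedeanLocalField F] [MeasurableSpace (GL (Fin 3) F)] [BorelSpace (GL (Fin 3) F)] in
/-- **The box Jacobian of a Levi element of `P_{(2,1)}`**: for `p ∈ M_{(2,1)}` (block `h = (p_{ij})_{i,j ≤ 1}`, corner `c = p₂₂`, `w = (p⁻¹)₂₂ = c⁻¹`) the `2 × 2` box matrix is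
`K_p = w · h`, so `det(1 − K_p) = (1 − p₀₀ w)(1 − p₁₁ w) − (p₀₁ w)(p₁₀ w)` (`= π_h(c)/c²`; for the companion block `!![0, −N₀; 1, T]`: `(c² − T c + N₀)/c²`, non-zero iff
`π(c) ≠ 0`, i.e. iff `leviBlock(C_π, c)` is regular). [cite: Rogawski1990, §4.13, proof of Lemma 4.13.1, p. 70] [cite: BernsteinZelevinsky1977, §2.1] -/
theorem det_one_sub_boxAd_of_mem_standardLeviGL (p : GL (Fin 3) F) (hp : p ∈ standardLeviGL F (![false, false, true] : Fin 3 → Bool)) :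
    (1 - Matrix.of fun q q' : {i : Fin 3 // (![false, false, true] : Fin 3 → Bool) i = false} × {j : Fin 3 // (![false, false, true] : Fin 3 → Bool) j = true} =>
      (((⟨p, standardLeviGL_le F _ hp⟩ : standardParabolicGL F (![false, false, true] : Fin 3 → Bool)) : GL (Fin 3) F) : Matrix (Fin 3) (Fin 3) F) q.1 q'.1 *
        ((((⟨p, standardLeviGL_le F _ hp⟩ : standardParabolicGL F (![false, false, true] : Fin 3 → Bool))⁻¹ : standardParabolicGL F (![false, false, true] : Fin 3 → Bool)) :
          GL (Fin 3) F) : Matrix (Fin 3) (Fin 3) F) q'.2 q.2).det =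
      (1 - (p : Matrix (Fin 3) (Fin 3) F) 0 0 * ((p⁻¹ : GL (Fin 3) F) : Matrix (Fin 3) (Fin 3) F) 2 2) *
          (1 - (p : Matrix (Fin 3) (Fin 3) F) 1 1 * ((p⁻¹ : GL (Fin 3) F) : Matrix (Fin 3) (Fin 3) F) 2 2) -
        ((p : Matrix (Fin 3) (Fin 3) F) 0 1 * ((p⁻¹ : GL (Fin 3) F) : Matrix (Fin 3) (Fin 3) F) 2 2) *
          ((p : Matrix (Fin 3) (Fin 3) F) 1 0 * ((p⁻¹ : GL (Fin 3) F) : Matrix (Fin 3) (Fin 3) F) 2 2) := by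
  classical
  -- the index type `{i : c i = false} × {j : c j = true}` is `{0,1} × {2}`; reindex by `Fin 2`
  set σ := {i : Fin 3 // (![false, false, true] : Fin 3 → Bool) i = false} × {j : Fin 3 // (![false, false, true] : Fin 3 → Bool) j = true} with hσ
  let e : Fin 2 → σ := fun k => Fin.cases (⟨0, rfl⟩, ⟨2, rfl⟩) (fun _ => (⟨1, rfl⟩, ⟨2, rfl⟩)) k
  have he_inj : Function.Injective e := by
    intro a b hab
    fin_cases a <;> fin_cases b
    · rfl
    · exact absurd (congrArg (fun q : σ => ((q.1 : Fin 3) : ℕ)) hab) (by decide)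
    · exact absurd (congrArg (fun q : σ => ((q.1 : Fin 3) : ℕ)) hab) (by decide)
    · rfl
  have he_surj : Function.Surjective e := by
    rintro ⟨⟨i, hi⟩, ⟨j, hj⟩⟩
    have hj2 : j = 2 := by fin_cases j <;> simp_all
    subst hj2
    fin_cases i
    · exact ⟨0, rfl⟩
    · exact ⟨1, rfl⟩
    · simp at hi
  let E : Fin 2 ≃ σ := Equiv.ofBijective e ⟨he_inj, he_surj⟩
  set A : Matrix σ σ F := 1 - Matrix.of fun q q' : σ =>
      (((⟨p, standardLeviGL_le F _ hp⟩ : standardParabolicGL F (![false, false, true] : Fin 3 → Bool)) : GL (Fin 3) F) : Matrix (Fin 3) (Fin 3) F) q.1 q'.1 *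
        ((((⟨p, standardLeviGL_le F _ hp⟩ : standardParabolicGL F (![false, false, true] : Fin 3 → Bool))⁻¹ : standardParabolicGL F (![false, false, true] : Fin 3 → Bool)) :
          GL (Fin 3) F) : Matrix (Fin 3) (Fin 3) F) q'.2 q.2 with hA
  have hre : A.det = (Matrix.reindex E.symm E.symm A).det := (Matrix.det_reindex_self E.symm A).symm
  rw [hre, Matrix.det_fin_two]
  simp only [Matrix.reindex_apply, Matrix.submatrix_apply, Equiv.symm_symm, hA, Matrix.sub_apply, Matrix.of_apply, Subgroup.coe_inv]
  -- evaluate the four entries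
  have hE0 : E 0 = (⟨0, rfl⟩, ⟨2, rfl⟩) := rfl
  have hE1 : E 1 = (⟨1, rfl⟩, ⟨2, rfl⟩) := rfl
  simp only [hE0, hE1, Matrix.one_apply_eq]
  change (1 - (p : Matrix (Fin 3) (Fin 3) F) 0 0 * ((p⁻¹ : GL (Fin 3) F) : Matrix (Fin 3) (Fin 3) F) 2 2) *
      (1 - (p : Matrix (Fin 3) (Fin 3) F) 1 1 * ((p⁻¹ : GL (Fin 3) F) : Matrix (Fin 3) (Fin 3) F) 2 2) -
      (0 - (p : Matrix (Fin 3) (Fin 3) F) 0 1 * ((p⁻¹ : GL (Fin 3) F) : Matrix (Fin 3) (Fin 3) F) 2 2) *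
        (0 - (p : Matrix (Fin 3) (Fin 3) F) 1 0 * ((p⁻¹ : GL (Fin 3) F) : Matrix (Fin 3) (Fin 3) F) 2 2) = _
  ring

end Count

end Summit.HodgeConjecture.HodgeConjecture.Cruxes.H413.K2E3GL3MixedShearCount

end
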